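import Literature.Analysis.FunctionSpaces.BesovPairing
import Literature.Analysis.FunctionSpaces.TemperedWeakStarCompactness
import HarnessLib

/-!
# Bounded sequences in a homogeneous Besov space have `𝓢'`-convergent subsequences

Analysis/FunctionSpaces support file (theorems only, fully proved): the first half of the **Fatou
property** of homogeneous Besov spaces (Bahouri–Chemin–Danchin 2011, Thm. 2.25: a bounded sequence
of `Ḃ^s_{p,r}`, `s < d/p`, has a subsequence converging in `𝓢'` to an element of `Ḃ^s_{p,r}` whose
norm is bounded by the `liminf` of the norms) — here the extraction of the `𝓢'`-convergent
subsequence, for the negative-regularity spaces `Ḃ^{-σ}_{p,∞} ∩ 𝓢'_h`, `0 < σ < 2`, `1 ≤ p ≤ ∞`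
(hence, by the monotonicity of the Besov scale in the third index, for every `Ḃ^{-σ}_{p,r}`):

* `exists_forall_norm_apply_le_of_eHomBesovNorm_le` — a sequence `u n ∈ 𝓢'_h` with
  `‖u n‖_{Ḃ^{-σ}_{p,∞}} ≤ M` is weak-* bounded: `‖⟨u n, θ⟩‖ ≤ K_θ M` (the embedding
  `Ḃ^{-σ}_{p,∞} ∩ 𝓢'_h ↪ 𝓢'`, `exists_nnnorm_apply_le_mul_eHomBesovNorm` of `BesovPairing.lean`,
  BCD Prop. 2.27);
* `exists_strictMono_tendsto_of_eHomBesovNorm_le` — hence (values in a finite-dimensional `F`) it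
  has a subsequence converging in `𝓢'(E, F)` (sequential Banach–Alaoglu for `𝓢'`,
  `TemperedDistribution.exists_strictMono_tendsto_of_forall_bddAbove` of
  `TemperedWeakStarCompactness.lean`);
* `eq_zero_of_eHomBesovNorm_eq_zero` — the embedding is injective: a realised distribution with
  vanishing `Ḃ^{-σ}_{p,∞}` norm is `0` (so `‖·‖_{Ḃ^{-σ}_{p,r}}` is a norm on `𝓢'_h`, BCD remark
  after Def. 2.15); `norm_apply_le_of_tendsto_of_eHomBesovNorm_le` — weak-* limits of realised
  bounded families keep the pairing bounds `‖⟨v, θ⟩‖ ≤ K_θ M`.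

This is the input "let `φ₁` be any weak limit point of `(f_n)`" of Koch's profile decomposition of
bounded sequences in `Ḃ^{s_p}_{p,p}` as used by Gallagher–Koch–Planchon (2016, Thm. 2; §2.3:
"`u_{0,n}` bounded … profile decomposition"; §2.4: "`φ_{j₀}` is the weak limit of `u_{0,n}`"), with
`s_p = -1 + 3/p ∈ (-1, 0)` for `3 < p < ∞`. The second half of BCD Thm. 2.25 (the limit lies in the
Besov space, with the Fatou bound) is not treated here.

## References

* H. Bahouri, J.-Y. Chemin, R. Danchin, *Fourier Analysis and Nonlinear Partial Differential
  Equations* (2011), Thm. 2.25 (Fatou property), Prop. 2.27 (`Ḃ^s_{p,r} ↪ 𝓢'_h`).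
  [cite: BahouriCheminDanchin2011, Prop. 2.27]
* I. Gallagher, G. S. Koch, F. Planchon, Comm. Math. Phys. 343 (2016) = arXiv:1407.4156, Thm. 2
  and §2.4. [cite: GKP2016, §2.4]
-/

noncomputable section

open Filter Set Function
open _root_.Topology
open scoped SchwartzMap NNReal ENNReal

namespace Literature.Analysis.FunctionSpaces

variable {E : Type*} [NormedAddCommGroup E] [InnerProductSpace ℝ E] [FiniteDimensional ℝ E]
  [MeasurableSpace E] [BorelSpace E] {F : Type*} [NormedAddCommGroup F] [NormedSpace ℂ F]
  [CompleteSpace F]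

/-- **Besov-bounded realised sequences are weak-* bounded** (the embedding
`Ḃ^{-σ}_{p,∞} ∩ 𝓢'_h ↪ 𝓢'`, BCD Prop. 2.27, uniformly along a sequence): if `0 < σ < 2`,
`1 ≤ p ≤ ∞`, every `u n` is realised (`Ṡ_j (u n) → 0` as `j → -∞`) and
`‖u n‖_{Ḃ^{-σ}_{p,∞}} ≤ M < ∞`, then for every test function `θ` the pairings `⟨u n, θ⟩` are
bounded: `‖⟨u n, θ⟩‖ ≤ K_θ M` (`exists_nnnorm_apply_le_mul_eHomBesovNorm`).
[cite: BahouriCheminDanchin2011, Prop. 2.27] -/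
theorem exists_forall_norm_apply_le_of_eHomBesovNorm_le (p : ℝ≥0∞) [Fact (1 ≤ p)] {σ : ℝ}
    (hσ : 0 < σ) (hσ2 : σ < 2) {u : ℕ → 𝓢'(E, F)}
    (hreal : ∀ n, Tendsto (fun j : ℤ => lowFreqCutoff j (u n)) atBot (𝓝 0)) {M : ℝ≥0}
    (hM : ∀ n, eHomBesovNorm (-σ) p ∞ (u n) ≤ M) (θ : 𝓢(E, ℂ)) :
    ∃ B : ℝ, ∀ n, ‖u n θ‖ ≤ B := by
  haveI : p.HolderConjugate (1 - p⁻¹)⁻¹ :=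
    ENNReal.HolderConjugate.inv_one_sub_inv' (Fact.out : 1 ≤ p)
  obtain ⟨K, hK⟩ :=
    exists_nnnorm_apply_le_mul_eHomBesovNorm (E := E) (F := F) p (1 - p⁻¹)⁻¹ hσ hσ2 θ
  refine ⟨(K : ℝ) * M, fun n => ?_⟩
  have h : (‖u n θ‖₊ : ℝ≥0∞) ≤ (K : ℝ≥0∞) * M :=
    (hK (u n) (hreal n)).trans (by gcongr; exact hM n)
  have h' : ‖u n θ‖₊ ≤ K * M := by exact_mod_cast h
  have h'' : (‖u n θ‖₊ : ℝ) ≤ (K : ℝ) * M := by exact_mod_cast h'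
  simpa only [coe_nnnorm] using h''

/-- **`Ḃ^{-σ}_{p,∞} ∩ 𝓢'_h ↪ 𝓢'` is injective: a realised distribution with vanishing
`Ḃ^{-σ}_{p,∞}` norm is zero** (`0 < σ < 2`, `1 ≤ p ≤ ∞`; BCD Prop. 2.27 / the remark after
Def. 2.15 that `‖·‖_{Ḃ^s_{p,r}}` is a norm on `𝓢'_h`): every pairing satisfies
`‖⟨u, θ⟩‖ ≤ K_θ ‖u‖_{Ḃ^{-σ}_{p,∞}} = 0`. (Without the realisation clause this fails: polynomials
have all dyadic blocks, hence Besov norm, equal to zero.) [cite: BahouriCheminDanchin2011, Prop. 2.27] -/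
theorem eq_zero_of_eHomBesovNorm_eq_zero (p : ℝ≥0∞) [Fact (1 ≤ p)] {σ : ℝ} (hσ : 0 < σ)
    (hσ2 : σ < 2) {u : 𝓢'(E, F)} (hreal : Tendsto (fun j : ℤ => lowFreqCutoff j u) atBot (𝓝 0))
    (hzero : eHomBesovNorm (-σ) p ∞ u = 0) : u = 0 := by
  haveI : p.HolderConjugate (1 - p⁻¹)⁻¹ :=
    ENNReal.HolderConjugate.inv_one_sub_inv' (Fact.out : 1 ≤ p)
  ext θ
  obtain ⟨K, hK⟩ :=
    exists_nnnorm_apply_le_mul_eHomBesovNorm (E := E) (F := F) p (1 - p⁻¹)⁻¹ hσ hσ2 θ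
  have h := hK u hreal
  rw [hzero, mul_zero, nonpos_iff_eq_zero, ENNReal.coe_eq_zero, nnnorm_eq_zero] at h
  simp [h]

/-- **Weak-* limits of realised `Ḃ^{-σ}_{p,∞}`-bounded families obey the pairing bounds of the
family**: if `u i → v` in `𝓢'` along a nontrivial filter, each `u i` is realised with
`‖u i‖_{Ḃ^{-σ}_{p,∞}} ≤ M`, then `‖⟨v, θ⟩‖ ≤ K_θ M` with the constant `K_θ` of
`exists_nnnorm_apply_le_mul_eHomBesovNorm` (bounds pass to weak-* limits,
`TemperedDistribution.norm_apply_le_of_tendsto`). This is the part of the Fatou property (BCD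
Thm. 2.25) that survives without identifying the limit's Besov norm. [cite: BahouriCheminDanchin2011, Prop. 2.27] -/
theorem norm_apply_le_of_tendsto_of_eHomBesovNorm_le (p : ℝ≥0∞) [Fact (1 ≤ p)] {σ : ℝ}
    (hσ : 0 < σ) (hσ2 : σ < 2) (θ : 𝓢(E, ℂ)) :
    ∃ K : ℝ≥0, ∀ {ι : Type*} {l : Filter ι} [l.NeBot] {u : ι → 𝓢'(E, F)} {v : 𝓢'(E, F)}
      {M : ℝ≥0}, Tendsto u l (𝓝 v) →
      (∀ i, Tendsto (fun j : ℤ => lowFreqCutoff j (u i)) atBot (𝓝 0)) →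
      (∀ i, eHomBesovNorm (-σ) p ∞ (u i) ≤ M) → ‖v θ‖ ≤ K * M := by
  haveI : p.HolderConjugate (1 - p⁻¹)⁻¹ :=
    ENNReal.HolderConjugate.inv_one_sub_inv' (Fact.out : 1 ≤ p)
  obtain ⟨K, hK⟩ :=
    exists_nnnorm_apply_le_mul_eHomBesovNorm (E := E) (F := F) p (1 - p⁻¹)⁻¹ hσ hσ2 θ
  refine ⟨K, fun {ι l _ u v M} hv hreal hM => ?_⟩
  refine TemperedDistribution.norm_apply_le_of_tendsto hv θ (Eventually.of_forall fun i => ?_)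
  have h : (‖u i θ‖₊ : ℝ≥0∞) ≤ (K : ℝ≥0∞) * M :=
    (hK (u i) (hreal i)).trans (by gcongr; exact hM i)
  have h' : ‖u i θ‖₊ ≤ K * M := by exact_mod_cast h
  have h'' : (‖u i θ‖₊ : ℝ) ≤ (K : ℝ) * M := by exact_mod_cast h'
  simpa only [coe_nnnorm] using h''

variable [ProperSpace F]

/-- **Bounded sequences of `Ḃ^{-σ}_{p,∞} ∩ 𝓢'_h` have `𝓢'`-convergent subsequences** (the
extraction half of the Fatou property, BCD Thm. 2.25; GKP 2016, Thm. 2: "let `φ₁` be any weak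
limit point of `(f_n)`"): for `0 < σ < 2`, `1 ≤ p ≤ ∞`, values in a finite-dimensional `F`, a
realised sequence with `‖u n‖_{Ḃ^{-σ}_{p,∞}} ≤ M < ∞` has a subsequence `u (φ n) → v` in `𝓢'(E, F)`
(`⟨u (φ n), θ⟩ → ⟨v, θ⟩` for every `θ`). Weak-* boundedness by
`exists_forall_norm_apply_le_of_eHomBesovNorm_le`, extraction by
`TemperedDistribution.exists_strictMono_tendsto_of_forall_bddAbove`.
[cite: BahouriCheminDanchin2011, Prop. 2.27] -/
theorem exists_strictMono_tendsto_of_eHomBesovNorm_le (p : ℝ≥0∞) [Fact (1 ≤ p)] {σ : ℝ}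
    (hσ : 0 < σ) (hσ2 : σ < 2) {u : ℕ → 𝓢'(E, F)}
    (hreal : ∀ n, Tendsto (fun j : ℤ => lowFreqCutoff j (u n)) atBot (𝓝 0)) {M : ℝ≥0}
    (hM : ∀ n, eHomBesovNorm (-σ) p ∞ (u n) ≤ M) :
    ∃ (v : 𝓢'(E, F)) (φ : ℕ → ℕ), StrictMono φ ∧ Tendsto (fun n => u (φ n)) atTop (𝓝 v) :=
  TemperedDistribution.exists_strictMono_tendsto_of_forall_bddAbove u
    fun θ => exists_forall_norm_apply_le_of_eHomBesovNorm_le p hσ hσ2 hreal hM θ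

/-- **The same for members of `Ḃ^{-σ}_{p,∞}`** (`MemHomBesov` carries the realisation clause):
a sequence in `Ḃ^{-σ}_{p,∞}` with norms `≤ M` has an `𝓢'`-convergent subsequence.
[cite: BahouriCheminDanchin2011, Prop. 2.27] -/
theorem exists_strictMono_tendsto_of_memHomBesov (p : ℝ≥0∞) [Fact (1 ≤ p)] {σ : ℝ}
    (hσ : 0 < σ) (hσ2 : σ < 2) {u : ℕ → 𝓢'(E, F)} (hmem : ∀ n, MemHomBesov (-σ) p ∞ (u n))
    {M : ℝ≥0} (hM : ∀ n, eHomBesovNorm (-σ) p ∞ (u n) ≤ M) :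
    ∃ (v : 𝓢'(E, F)) (φ : ℕ → ℕ), StrictMono φ ∧ Tendsto (fun n => u (φ n)) atTop (𝓝 v) :=
  exists_strictMono_tendsto_of_eHomBesovNorm_le p hσ hσ2 (fun n => (hmem n).tendsto_lowFreqCutoff)
    hM

end Literature.Analysis.FunctionSpaces
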